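import Literature.Probability.RandomPlanarGeometry.SLETraceStrongMarkov
import Literature.Probability.RandomPlanarGeometry.LoewnerShiftKoebe
import Literature.Probability.RandomPlanarGeometry.SLEOnePointUpperEstimate
import HarnessLib

/-!
# Hitting a disc after a stopping time: the conditional one-point estimate (Beffara's Cor. 5 step)

Topic `Probability/RandomPlanarGeometry`; theorems and small definitions. For `0 < κ < 8` with
`HasSLETrace κ`, a stopping time `τ` of the raw Brownian filtration, an event `A ∈ 𝓕ᵂ_τ`, a point
`y ∈ ℍ` and `ε > 0`, this file bounds the probability that **after `τ` the SLE_κ trace comes within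
`ε` of `y`**, on the part of `A ∩ {τ < ∞}` where `y` is still alive with localisation index `n`
(`τ ≤ ρₙ(y)`) and `ε ≤ Im y/(128 π ψ_τ(y))`:

  `P[A, τ < ∞, τ ≤ ρₙ(y), ε ≤ Im y/(128πψ_τ(y)), ∃ u, |γ(τ+u) - y| ≤ ε]`
    `≤ C_κ ∫_{A ∩ {τ<∞} ∩ {τ ≤ ρₙ(y)} ∩ {ε ≤ …}} (4 ε ψ_τ(y)/Im y)^{1-κ/8} Ĝ(Re z_τ/Im z_τ) dP`

(`exists_const_measureReal_hitAfter_le`), where `z_τ = g_τ(y) - W_τ`, `ψ_τ(y) = Im y |g_τ'(y)|/Im g_τ(y)`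
(so `4εψ_τ/Im y = 4ε|g_τ'(y)|/Im z_τ`) and `Ĝ = Ĝ_{1-κ/8,κ}`. This is Beffara's use of the Markov
property at `T_ε(z)` followed by the first-moment estimate in the slit domain (Ann. Probab. 36
(2008), §3, with Cor. 5), assembled from: the conformal Markov property of the trace at a stopping
time in freezing form (`setIntegral_sleTraceAfter_eq_setIntegral_integral`), the deterministic Koebe
step (`IsGeneratedByCurve.infDist_centredMap_shift_le`: the shifted trace must come within
`4ε|g_τ'(y)|` of `z_τ`), and the sharp one-point upper estimate at the frozen data
(`measure_infDist_sleTrace_le_sharp'`).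

## References

* V. Beffara, *The dimension of the SLE curves*, Ann. Probab. 36 (2008), Cor. 5, §3.
* S. Rohde, O. Schramm, *Basic properties of SLE*, Ann. of Math. 161 (2005), §7.
* G. F. Lawler, *Conformally Invariant Processes in the Plane*, AMS (2005), §6.2.
-/

noncomputable section

open Set Filter MeasureTheory Metric Complex
open _root_.Topology
open UpperHalfPlane (upperHalfPlaneSet)
open scoped NNReal ENNReal Real

namespace Literature.Probability.RandomPlanarGeometry

open Loewner Literature.Probability.Process Literature.Analysis.FunctionSpaces

/-! ### A measurable version of `{infDist x (range γ) ≤ ρ}` on the path space -/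

section NearSet

/-- **The near set**: pairs `((x, ρ), γ)` such that for every `k`, some non-negative rational time `q`
has `|γ(q) - x| < ρ + 1/(k+1)`; measurable for the product σ-algebra, and equal to
`{infDist x (range γ) ≤ ρ}` along continuous paths. [folklore] -/
def nearSet : Set ((ℂ × ℝ) × (ℝ≥0 → ℂ)) :=
  {p | ∀ k : ℕ, ∃ q : ℚ, ‖p.2 ((q : ℝ).toNNReal) - p.1.1‖ < p.1.2 + 1 / ((k : ℝ) + 1)}

/-- The near set is measurable. [folklore] -/
theorem measurableSet_nearSet : MeasurableSet nearSet := by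
  have h : nearSet = ⋂ k : ℕ, ⋃ q : ℚ, {p : (ℂ × ℝ) × (ℝ≥0 → ℂ) |
      ‖p.2 ((q : ℝ).toNNReal) - p.1.1‖ < p.1.2 + 1 / ((k : ℝ) + 1)} := by
    ext p; simp only [nearSet, mem_setOf_eq, mem_iInter, mem_iUnion]
  rw [h]
  refine MeasurableSet.iInter fun k ↦ MeasurableSet.iUnion fun q ↦ ?_
  have h1 : Measurable fun p : (ℂ × ℝ) × (ℝ≥0 → ℂ) ↦ p.2 ((q : ℝ).toNNReal) :=
    (measurable_pi_apply ((q : ℝ).toNNReal)).comp measurable_snd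
  have h2 : Measurable fun p : (ℂ × ℝ) × (ℝ≥0 → ℂ) ↦ p.1.1 := measurable_fst.comp measurable_fst
  have h3 : Measurable fun p : (ℂ × ℝ) × (ℝ≥0 → ℂ) ↦ p.1.2 := measurable_snd.comp measurable_fst
  exact measurableSet_lt (h1.sub h2).norm (h3.add measurable_const)

/-- **Along a continuous path, the near set is `{infDist x (range γ) ≤ ρ}`.** [folklore] -/
theorem mem_nearSet_iff {x : ℂ × ℝ} {γ : ℝ≥0 → ℂ} (hγ : Continuous γ) :
    ((x, γ) ∈ nearSet) ↔ infDist x.1 (range γ) ≤ x.2 := by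
  constructor
  · intro h
    refine le_of_forall_pos_lt_add fun δ hδ ↦ ?_
    obtain ⟨k, hk⟩ := exists_nat_one_div_lt hδ
    obtain ⟨q, hq⟩ := h k
    calc infDist x.1 (range γ) ≤ dist x.1 (γ ((q : ℝ).toNNReal)) := infDist_le_dist_of_mem (mem_range_self _)
      _ = ‖γ ((q : ℝ).toNNReal) - x.1‖ := by rw [dist_comm, dist_eq_norm]
      _ < x.2 + 1 / ((k : ℝ) + 1) := hq
      _ < x.2 + δ := by linarith
  · intro h k
    have hk : (0 : ℝ) < 1 / ((k : ℝ) + 1) := by positivity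
    have hlt : infDist x.1 (range γ) < x.2 + 1 / ((k : ℝ) + 1) := by linarith
    obtain ⟨_, ⟨u, rfl⟩, hu⟩ := (infDist_lt_iff (range_nonempty γ)).1 hlt
    rw [dist_comm, dist_eq_norm] at hu
    -- a rational time near `u`
    have hopen : IsOpen {t : ℝ≥0 | ‖γ t - x.1‖ < x.2 + 1 / ((k : ℝ) + 1)} :=
      isOpen_lt (continuous_norm.comp (hγ.sub continuous_const)) continuous_const
    obtain ⟨q, hq⟩ := denseRange_toNNReal_ratCast.exists_mem_open hopen ⟨u, hu⟩
    exact ⟨q, hq⟩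

end NearSet

/-! ### The inner estimate: the one-point bound at frozen data -/

section Inner

variable {κ : ℝ≥0}

/-- **The inner integral is the one-point hitting probability**, bounded by the sharp estimate:
for `x = (z', ρ')` with `Im z' > 0`, `0 < ρ' ≤ Im z'/2`,
`∫ 𝟙_{nearSet}((x, γ(ω'))) dω' ≤ C (ρ'/Im z')^{1-κ/8} Ĝ(Re z'/Im z')` with the constant of
`measure_infDist_sleTrace_le_sharp'` (`η = 1/2`, made non-negative). [folklore] -/
theorem exists_const_integral_nearSet_le (hκ : 0 < κ) (hκ8 : κ < 8) (h0 : HasSLETrace κ) :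
    ∃ C : ℝ, 0 ≤ C ∧ ∀ x : ℂ × ℝ, 0 < x.1.im → 0 < x.2 → x.2 ≤ x.1.im / 2 →
      ∫ ω', nearSet.indicator (fun _ ↦ (1 : ℝ)) (x, sleTrace κ ω') ∂preWienerMeasure ≤
        C * (x.2 / x.1.im) ^ (1 - (κ : ℝ) / 8) * rsGhatSlope (1 - (κ : ℝ) / 8) κ (x.1.re / x.1.im) := by
  haveI := isProbabilityMeasure_preWienerMeasure'
  obtain ⟨C, hC⟩ := measure_infDist_sleTrace_le_sharp' hκ hκ8 h0 (η := 1 / 2) (by norm_num) (by norm_num)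
  obtain ⟨T, hTm, hT⟩ := Loewner.exists_measurable_eq_trace
  refine ⟨max C 0, le_max_right _ _, fun x hx1 hx2 hx3 ↦ ?_⟩
  set Good : Set (ℝ≥0 → ℝ) := {ω | ∃ γ, IsGeneratedByCurve (sleDriving κ ω) γ} with hGood
  have hGc : preWienerMeasure Goodᶜ = 0 := by
    have h : ∀ᵐ ω ∂preWienerMeasure, ω ∈ Good := h0
    exact mem_ae_iff.1 (Filter.eventually_iff.1 h)
  have hTeq : ∀ ω ∈ Good, T (sleDriving κ ω) = sleTrace κ ω := fun ω hω ↦ hT _ (continuous_sleDriving κ ω) hω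
  set ExT : Set (ℝ≥0 → ℝ) := {ω | (x, T (sleDriving κ ω)) ∈ nearSet} with hExT
  have hExTm : MeasurableSet ExT :=
    (measurable_const.prodMk (hTm.comp (measurable_sleDriving_pi κ))) measurableSet_nearSet
  -- the integrand is a.e. the indicator of the measurable set `ExT`
  have hae : (fun ω ↦ nearSet.indicator (fun _ ↦ (1 : ℝ)) (x, sleTrace κ ω)) =ᵐ[preWienerMeasure]
      ExT.indicator fun _ ↦ (1 : ℝ) := by
    have h : ∀ᵐ ω ∂preWienerMeasure, ω ∈ Good := h0
    filter_upwards [h] with ω hω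
    rw [← hTeq ω hω]
    by_cases hmem : (x, T (sleDriving κ ω)) ∈ nearSet
    · rw [Set.indicator_of_mem hmem, Set.indicator_of_mem (show ω ∈ ExT from hmem)]
    · rw [Set.indicator_of_notMem hmem, Set.indicator_of_notMem (show ω ∉ ExT from hmem)]
  rw [integral_congr_ae hae, MeasureTheory.integral_indicator hExTm, setIntegral_const, smul_eq_mul, mul_one]
  -- `ExT ⊆ {infDist ≤ ρ'} ∪ Goodᶜ`
  have hsub : ExT ⊆ {ω | infDist x.1 (Set.range (sleTrace κ ω)) ≤ x.2} ∪ Goodᶜ := by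
    intro ω hω
    by_cases hg : ω ∈ Good
    · left
      have hcont : Continuous (sleTrace κ ω) := (Loewner.isGeneratedByCurve_trace hg).1
      have := (mem_nearSet_iff (x := x) hcont).1 (by rw [← hTeq ω hg]; exact hω)
      exact this
    · exact Or.inr hg
  have hbound := hC hx1 hx2 (by linarith)
  have hnn : 0 ≤ max C 0 * (x.2 / x.1.im) ^ (1 - (κ : ℝ) / 8) * rsGhatSlope (1 - (κ : ℝ) / 8) κ (x.1.re / x.1.im) := by
    have := (rsGhatSlope_critical_mem_Ioc (by exact_mod_cast hκ) (by exact_mod_cast hκ8.le) (x.1.re / x.1.im)).1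
    have := Real.rpow_nonneg (div_nonneg hx2.le hx1.le) (1 - (κ : ℝ) / 8)
    positivity
  refine ENNReal.toReal_le_of_le_ofReal hnn ?_
  calc preWienerMeasure ExT ≤ preWienerMeasure ({ω | infDist x.1 (Set.range (sleTrace κ ω)) ≤ x.2} ∪ Goodᶜ) :=
        measure_mono hsub
    _ ≤ preWienerMeasure {ω | infDist x.1 (Set.range (sleTrace κ ω)) ≤ x.2} + preWienerMeasure Goodᶜ :=
        measure_union_le _ _
    _ = preWienerMeasure {ω | infDist x.1 (Set.range (sleTrace κ ω)) ≤ x.2} := by rw [hGc, add_zero]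
    _ ≤ ENNReal.ofReal (C * (x.2 / x.1.im) ^ (1 - (κ : ℝ) / 8) * rsGhatSlope (1 - (κ : ℝ) / 8) κ (x.1.re / x.1.im)) :=
        hbound
    _ ≤ ENNReal.ofReal (max C 0 * (x.2 / x.1.im) ^ (1 - (κ : ℝ) / 8) *
          rsGhatSlope (1 - (κ : ℝ) / 8) κ (x.1.re / x.1.im)) := by
        refine ENNReal.ofReal_le_ofReal (mul_le_mul_of_nonneg_right (mul_le_mul_of_nonneg_right
          (le_max_left _ _) (Real.rpow_nonneg (div_nonneg hx2.le hx1.le) _)) ?_)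
        exact (rsGhatSlope_critical_mem_Ioc (by exact_mod_cast hκ) (by exact_mod_cast hκ8.le) _).1.le

/-- The inner integral agrees with its measurable version (`T` the measurable trace functional).
[folklore] -/
theorem integral_nearSet_eq_of_functional (h0 : HasSLETrace κ) {T : (ℝ≥0 → ℝ) → ℝ≥0 → ℂ}
    (hT : ∀ U : ℝ≥0 → ℝ, Continuous U → (∃ γ, IsGeneratedByCurve U γ) → T U = Loewner.trace U)
    (x : ℂ × ℝ) :
    ∫ ω', nearSet.indicator (fun _ ↦ (1 : ℝ)) (x, sleTrace κ ω') ∂preWienerMeasure =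
      ∫ ω', nearSet.indicator (fun _ ↦ (1 : ℝ)) (x, T (sleDriving κ ω')) ∂preWienerMeasure := by
  refine integral_congr_ae ?_
  have h : ∀ᵐ ω ∂preWienerMeasure, ∃ γ, IsGeneratedByCurve (sleDriving κ ω) γ := h0
  filter_upwards [h] with ω hω
  rw [hT _ (continuous_sleDriving κ ω) hω]
  rfl

end Inner

/-! ### The conditional hitting estimate after a stopping time -/

section Main

variable (κ : ℝ≥0) (y : ℂ) (n : ℕ) (τ : (ℝ≥0 → ℝ) → WithTop ℝ≥0)

/-- `Re z_τ` read on the flow localised by `ρₙ(y)` (meaningful on `{τ ≤ ρₙ(y)}`). [folklore] -/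
def sleReAt (ω : ℝ≥0 → ℝ) : ℝ := stoppedProcess (slePointRe κ y) (slePointLocTime κ y n) (τ ω).untopA ω

/-- `Im z_τ` read on the localised flow. [folklore] -/
def sleImAt (ω : ℝ≥0 → ℝ) : ℝ := stoppedProcess (slePointIm κ y) (slePointLocTime κ y n) (τ ω).untopA ω

/-- `ψ_τ(y)` read on the localised flow. [folklore] -/
def slePsiAt (ω : ℝ≥0 → ℝ) : ℝ := stoppedProcess (slePointPsi κ y) (slePointLocTime κ y n) (τ ω).untopA ω

/-- **The event "after `τ` the trace comes within `ε` of `y`"**: `∃ u, |γ(τ + u) - y| ≤ ε`, `τ < ∞`.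
[cite: Beffara2008, §3] -/
def sleHitAfter (ε : ℝ) : Set (ℝ≥0 → ℝ) :=
  {ω | ∃ r : ℝ≥0, τ ω = r ∧ ∃ u : ℝ≥0, ‖sleTrace κ ω (r + u) - y‖ ≤ ε}

/-- **The admissible event**: `τ ≤ ρₙ(y)` (so `y` is alive at `τ` with localisation index `n`) and
`ε ≤ Im y/(128 π ψ_τ(y))` (the Koebe range). [folklore] -/
def sleKoebeAt (ε : ℝ) : Set (ℝ≥0 → ℝ) :=
  {ω | τ ω ≤ slePointLocTime κ y n ω} ∩ {ω | ε ≤ y.im / (128 * π * slePsiAt κ y n τ ω)}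

variable {κ y n τ}

/-- On `{τ = r ≤ ρₙ(y)}`: the localised readings are the flow quantities at `r`. [folklore] -/
theorem sleAt_eq_of_eq_coe (hy : 0 < y.im) {ω : ℝ≥0 → ℝ} {r : ℝ≥0} (hr : τ ω = r)
    (hrρ : ((r : ℝ≥0) : WithTop ℝ≥0) ≤ slePointLocTime κ y n ω) :
    sleReAt κ y n τ ω = (centredMap (sleDriving κ ω) r y).re ∧
      sleImAt κ y n τ ω = (centredMap (sleDriving κ ω) r y).im ∧
      slePsiAt κ y n τ ω = derivRatio (sleDriving κ ω) y r := by
  have hr' : (τ ω).untopA = r := by rw [hr]; rfl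
  have hlt := coe_lt_swallowingTime_of_le_locTime hy hrρ
  simp only [sleReAt, sleImAt, slePsiAt, hr', stoppedProcess_eq_of_le hrρ]
  exact ⟨rfl, slePointIm_of_lt hlt, slePointPsi_apply _ _⟩

/-- The localised readings are `𝓕ᵂ_τ`-measurable. [folklore] -/
theorem measurable_sleAt (hy : 0 < y.im) (hτ : IsStoppingTime brownianFiltration τ) :
    Measurable[hτ.measurableSpace] (sleReAt κ y n τ) ∧ Measurable[hτ.measurableSpace] (sleImAt κ y n τ) ∧
      Measurable[hτ.measurableSpace] (slePsiAt κ y n τ) := by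
  have hρ := isStoppingTime_slePointLocTime κ hy n
  have hle : ∀ ω, slePointLocTime κ y n ω ≤ slePointLocTime κ y n ω := fun _ ↦ le_rfl
  have h1 : IsStronglyProgressive brownianFiltration (stoppedProcess (slePointRe κ y) (slePointLocTime κ y n)) :=
    (stronglyAdapted_stoppedProcess_slePointRe hy hρ).isStronglyProgressive_of_continuous
      (continuous_stoppedProcess_slePointRe hy hle)
  have h2 : IsStronglyProgressive brownianFiltration (stoppedProcess (slePointIm κ y) (slePointLocTime κ y n)) :=
    (stronglyAdapted_stoppedProcess_slePointIm hy hρ).isStronglyProgressive_of_continuous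
      (continuous_stoppedProcess_slePointIm hy _)
  have h3 : IsStronglyProgressive brownianFiltration (stoppedProcess (slePointPsi κ y) (slePointLocTime κ y n)) :=
    (stronglyAdapted_stoppedProcess_slePointPsi hy hρ hle).isStronglyProgressive_of_continuous
      (continuous_stoppedProcess_slePointPsi hy hle)
  exact ⟨measurable_stoppedValue h1 hτ, measurable_stoppedValue h2 hτ, measurable_stoppedValue h3 hτ⟩

/-- **Hitting a disc after a stopping time (Beffara's Markov + Cor. 5 step).** For `0 < κ < 8` with
`HasSLETrace κ` there is `C ≥ 0` (depending only on `κ`) such that for every `y ∈ ℍ`, `n`, every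
stopping time `τ` of the raw Brownian filtration, every `A ∈ 𝓕ᵂ_τ` and every `ε > 0`:
`P[A ∩ {τ<∞} ∩ {τ ≤ ρₙ(y), ε ≤ Im y/(128πψ_τ)} ∩ {∃ u, |γ(τ+u) - y| ≤ ε}]`
`≤ C ∫_{A ∩ {τ<∞} ∩ {τ ≤ ρₙ(y), ε ≤ …}} (4εψ_τ(y)/Im y)^{1-κ/8} Ĝ_{1-κ/8,κ}(Re z_τ/Im z_τ) dP`.
Proof: freeze `X = (z_τ, 4ε|g_τ'(y)|)` (`𝓕ᵂ_τ`-measurable) and `F = 𝟙_{nearSet}`; on the event, the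
shifted trace `γ^τ` comes within `4ε|g_τ'(y)|` of `z_τ` (`IsGeneratedByCurve.infDist_centredMap_shift_le`),
so the probability is at most `E[F(X, γ^τ); A']` `=` (conformal Markov,
`setIntegral_sleTraceAfter_eq_setIntegral_integral`) `E[P'[dist(z_τ, γ') ≤ 4ε|g_τ'(y)|]; A']`, and the
inner probability is bounded by the sharp one-point estimate (`exists_const_integral_nearSet_le`,
`4ε|g_τ'(y)| ≤ Im z_τ/2`). [cite: Beffara2008, Cor. 5] -/
theorem exists_const_measureReal_hitAfter_le (hκ : 0 < κ) (hκ8 : κ < 8) (h0 : HasSLETrace κ) :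
    ∃ C : ℝ, 0 ≤ C ∧ ∀ {y : ℂ}, 0 < y.im → ∀ (n : ℕ) {τ : (ℝ≥0 → ℝ) → WithTop ℝ≥0}
      (hτ : IsStoppingTime brownianFiltration τ) {A : Set (ℝ≥0 → ℝ)},
      MeasurableSet[hτ.measurableSpace] A → ∀ {ε : ℝ}, 0 < ε →
      preWienerMeasure.real (A ∩ {ω | τ ω ≠ ⊤} ∩ sleKoebeAt κ y n τ ε ∩ sleHitAfter κ y τ ε) ≤
        C * ∫ ω in A ∩ sleKoebeAt κ y n τ ε ∩ {ω | τ ω ≠ ⊤},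
          (4 * ε * slePsiAt κ y n τ ω / y.im) ^ (1 - (κ : ℝ) / 8) *
            rsGhatSlope (1 - (κ : ℝ) / 8) κ (sleReAt κ y n τ ω / sleImAt κ y n τ ω) ∂preWienerMeasure := by
  haveI := isProbabilityMeasure_preWienerMeasure'
  obtain ⟨C, hC0, hC⟩ := exists_const_integral_nearSet_le hκ hκ8 h0
  obtain ⟨T, hTm, hT⟩ := Loewner.exists_measurable_eq_trace
  refine ⟨C, hC0, fun {y} hy n {τ} hτ {A} hA {ε} hε ↦ ?_⟩
  set P := preWienerMeasure with hP
  set a : ℝ := 1 - (κ : ℝ) / 8 with ha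
  set ρy := slePointLocTime κ y n with hρy
  have hρst := isStoppingTime_slePointLocTime κ hy n
  obtain ⟨hRe, hIm, hPsi⟩ := measurable_sleAt (κ := κ) (n := n) hy hτ
  -- the frozen data `X = (z_τ, ρ')`
  set X : (ℝ≥0 → ℝ) → ℂ × ℝ := fun ω ↦ ((sleReAt κ y n τ ω : ℂ) + (sleImAt κ y n τ ω : ℂ) * I,
    4 * ε * slePsiAt κ y n τ ω * sleImAt κ y n τ ω / y.im) with hX
  have hX : Measurable[hτ.measurableSpace] X := by
    refine Measurable.prodMk ?_ ?_
    · exact (Complex.measurable_ofReal.comp hRe).add ((Complex.measurable_ofReal.comp hIm).mul_const I)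
    · exact ((hPsi.const_mul _).mul hIm).div_const _
  have hX1re : ∀ ω, (X ω).1.re = sleReAt κ y n τ ω := fun ω ↦ by
    show ((sleReAt κ y n τ ω : ℂ) + (sleImAt κ y n τ ω : ℂ) * I).re = _; simp
  have hX1im : ∀ ω, (X ω).1.im = sleImAt κ y n τ ω := fun ω ↦ by
    show ((sleReAt κ y n τ ω : ℂ) + (sleImAt κ y n τ ω : ℂ) * I).im = _; simp
  have hX2 : ∀ ω, (X ω).2 = 4 * ε * slePsiAt κ y n τ ω * sleImAt κ y n τ ω / y.im := fun ω ↦ rfl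
  -- the event `A' ∈ 𝓕_τ`
  set A' : Set (ℝ≥0 → ℝ) := A ∩ sleKoebeAt κ y n τ ε with hA'
  have hA' : MeasurableSet[hτ.measurableSpace] A' := by
    have hq : Measurable[hτ.measurableSpace] fun ω ↦ y.im / (128 * π * slePsiAt κ y n τ ω) :=
      Measurable.div (@measurable_const _ _ _ hτ.measurableSpace _) (hPsi.const_mul (128 * π))
    exact hA.inter (MeasurableSet.inter (IsStoppingTime.measurableSet_le_stopping_time hτ hρst)
      (measurableSet_le (@measurable_const _ _ _ hτ.measurableSpace ε) hq))
  have hA'm : MeasurableSet (A' ∩ {ω | τ ω ≠ ⊤}) := (hτ.measurableSpace_le _ hA').inter (measurableSet_ne_top hτ)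
  -- the functional
  set F : ℂ × ℝ → (ℝ≥0 → ℂ) → ℝ := fun x γ' ↦ nearSet.indicator (fun _ ↦ (1 : ℝ)) (x, γ') with hF
  have hFm : Measurable (Function.uncurry F) := by
    have : Function.uncurry F = nearSet.indicator fun _ ↦ (1 : ℝ) := by
      funext p; rfl
    rw [this]; exact measurable_const.indicator measurableSet_nearSet
  have hFb : ∀ x γ', |F x γ'| ≤ 1 := fun x γ' ↦ by
    simp only [hF]; by_cases h : (x, γ') ∈ nearSet <;> simp [h]
  have hF01 : ∀ x γ', 0 ≤ F x γ' := fun x γ' ↦ Set.indicator_nonneg (fun _ _ ↦ zero_le_one) _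
  -- conformal Markov property (freezing form)
  have hfreeze := setIntegral_sleTraceAfter_eq_setIntegral_integral h0 hτ hX hFm hFb hA'
  ----------------------------------------------------------------
  -- Step 1: lower bound of the left side by the probability of the event
  have hgood1 := ae_sleTrace_add_eq_extendFrom_stoppingTime (κ := κ) h0 hτ
  have hgood2 := ae_exists_isGeneratedByCurve_incrAfter (κ := κ) h0 hτ
  have hgood0 : ∀ᵐ ω ∂P, ∃ γ, IsGeneratedByCurve (sleDriving κ ω) γ := h0
  -- measurable version of `F(X, γ^τ)`
  set GT : Set (ℝ≥0 → ℝ) := {ω | (X ω, T (sleDrivingAfter κ τ ω)) ∈ nearSet} with hGT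
  have hXm : Measurable X := hX.mono hτ.measurableSpace_le le_rfl
  have hDm : Measurable fun ω ↦ sleDrivingAfter κ τ ω := by
    have h1 : Measurable fun (ω : ℝ≥0 → ℝ) (u : ℝ≥0) ↦ brownianIncrAfter τ u ω :=
      measurable_brownianIncrAfter_pi hτ.measurable'
    exact (measurable_pi_lambda _ fun u ↦ (measurable_pi_apply u).const_mul _).comp h1
  have hGTm : MeasurableSet GT := (hXm.prodMk (hTm.comp hDm)) measurableSet_nearSet
  -- on the good set, the event forces `GT`
  have hincl : ∀ᵐ ω ∂P, ω ∈ A' ∩ {ω | τ ω ≠ ⊤} ∩ sleHitAfter κ y τ ε → ω ∈ GT ∩ (A' ∩ {ω | τ ω ≠ ⊤}) := by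
    filter_upwards [hgood0, hgood1, hgood2] with ω hω0 hω1 hω2 hωmem
    obtain ⟨⟨hωA', hωne⟩, r, hr, u, hu⟩ := hωmem
    refine ⟨?_, hωA', hωne⟩
    have hgenτ := hω2 hωne
    have hW := continuous_sleDriving κ ω
    have hγ := Loewner.isGeneratedByCurve_trace hω0
    have heqD : sleDrivingAfter κ τ ω = fun u ↦ sleDriving κ ω (r + u) - sleDriving κ ω r :=
      funext fun u ↦ sleDrivingAfter_of_eq_coe hr u
    have hγs : IsGeneratedByCurve (fun u ↦ sleDriving κ ω (r + u) - sleDriving κ ω r) (sleTraceAfter κ τ ω) := by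
      rw [sleTraceAfter, heqD]; rw [heqD] at hgenτ; exact Loewner.isGeneratedByCurve_trace hgenτ
    have hrρ : ((r : ℝ≥0) : WithTop ℝ≥0) ≤ slePointLocTime κ y n ω := by rw [← hr]; exact hωA'.2.1
    have hrT := coe_lt_swallowingTime_of_le_locTime hy hrρ
    obtain ⟨hre, him, hpsi⟩ := sleAt_eq_of_eq_coe (κ := κ) (n := n) hy hr hrρ
    have hεK : ε ≤ y.im / (128 * π * derivRatio (sleDriving κ ω) y r) := by rw [← hpsi]; exact hωA'.2.2
    obtain ⟨-, hinf⟩ := hγ.infDist_centredMap_shift_le hW hγs hy hrT hε hεK hu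
    -- identify `X ω`
    have hX1 : (X ω).1 = centredMap (sleDriving κ ω) r y := by
      apply Complex.ext
      · rw [hX1re, hre]
      · rw [hX1im, him]
    have hX2' : (X ω).2 = 4 * ε * ‖deriv (Loewner.map (sleDriving κ ω) r) y‖ := by
      rw [hX2, hpsi, him, derivRatio_apply, im_centredMap]
      have hpos : 0 < (Loewner.map (sleDriving κ ω) r y).im := by
        have := im_centredMap_pos hW hy hrT; rwa [im_centredMap] at this
      field_simp
    have hcontτ : Continuous (sleTraceAfter κ τ ω) := hγs.1
    have hmem : (X ω, sleTraceAfter κ τ ω) ∈ nearSet := by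
      rw [mem_nearSet_iff hcontτ, hX1, hX2']
      exact hinf
    show (X ω, T (sleDrivingAfter κ τ ω)) ∈ nearSet
    rwa [hT _ (continuous_sleDrivingAfter ω) hgenτ, ← sleTraceAfter]
  -- hence `P(event) ≤ P(GT ∩ (A' ∩ {τ≠⊤})) = ∫_{A'∩{τ≠⊤}} 𝟙_{GT} = ∫_{A'∩{τ≠⊤}} F(X, γ^τ)`
  have hstep1 : P.real (A ∩ {ω | τ ω ≠ ⊤} ∩ sleKoebeAt κ y n τ ε ∩ sleHitAfter κ y τ ε) ≤
      ∫ ω in A' ∩ {ω | τ ω ≠ ⊤}, F (X ω) (sleTraceAfter κ τ ω) ∂P := by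
    have hset : A ∩ {ω | τ ω ≠ ⊤} ∩ sleKoebeAt κ y n τ ε ∩ sleHitAfter κ y τ ε =
        A' ∩ {ω | τ ω ≠ ⊤} ∩ sleHitAfter κ y τ ε :=
      Set.ext fun ω ↦ ⟨fun h ↦ ⟨⟨⟨h.1.1.1, h.1.2⟩, h.1.1.2⟩, h.2⟩, fun h ↦ ⟨⟨⟨h.1.1.1, h.1.2⟩, h.1.1.2⟩, h.2⟩⟩
    rw [hset]
    have h1 : P.real (A' ∩ {ω | τ ω ≠ ⊤} ∩ sleHitAfter κ y τ ε) ≤ P.real (GT ∩ (A' ∩ {ω | τ ω ≠ ⊤})) :=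
      ENNReal.toReal_mono (measure_ne_top _ _) (measure_mono_ae hincl)
    have h2 : P.real (GT ∩ (A' ∩ {ω | τ ω ≠ ⊤})) = ∫ ω in A' ∩ {ω | τ ω ≠ ⊤}, GT.indicator (fun _ ↦ (1 : ℝ)) ω ∂P := by
      rw [setIntegral_indicator hGTm, setIntegral_const, smul_eq_mul, mul_one, Set.inter_comm]
    have h3 : ∫ ω in A' ∩ {ω | τ ω ≠ ⊤}, GT.indicator (fun _ ↦ (1 : ℝ)) ω ∂P =
        ∫ ω in A' ∩ {ω | τ ω ≠ ⊤}, F (X ω) (sleTraceAfter κ τ ω) ∂P := by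
      refine setIntegral_congr_ae hA'm ?_
      filter_upwards [hgood2] with ω hω2 hωmem
      have hgenτ := hω2 hωmem.2
      have hT' : T (sleDrivingAfter κ τ ω) = sleTraceAfter κ τ ω :=
        (hT _ (continuous_sleDrivingAfter ω) hgenτ).trans rfl
      simp only [hF]
      rw [← hT']
      by_cases hmem : (X ω, T (sleDrivingAfter κ τ ω)) ∈ nearSet
      · rw [Set.indicator_of_mem hmem, Set.indicator_of_mem (show ω ∈ GT from hmem)]
      · rw [Set.indicator_of_notMem hmem, Set.indicator_of_notMem (show ω ∉ GT from hmem)]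
    linarith [h1, h2.le, h2.ge, h3.le, h3.ge]
  ----------------------------------------------------------------
  -- Step 2: the right side of the freezing formula is bounded by the sharp one-point estimate
  -- measurable version of the inner integral
  have hinnerT : ∀ x, ∫ ω', F x (sleTrace κ ω') ∂P = ∫ ω', nearSet.indicator (fun _ ↦ (1 : ℝ)) (x, T (sleDriving κ ω')) ∂P :=
    fun x ↦ integral_nearSet_eq_of_functional h0 hT x
  have hinnerm : Measurable fun x : ℂ × ℝ ↦ ∫ ω', F x (sleTrace κ ω') ∂P := by
    have hG : Measurable (Function.uncurry fun (x : ℂ × ℝ) (ω' : ℝ≥0 → ℝ) ↦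
        nearSet.indicator (fun _ ↦ (1 : ℝ)) (x, T (sleDriving κ ω'))) :=
      (measurable_const.indicator measurableSet_nearSet).comp
        (measurable_fst.prodMk ((hTm.comp (measurable_sleDriving_pi κ)).comp measurable_snd))
    have h2 : StronglyMeasurable fun x : ℂ × ℝ ↦ ∫ ω', nearSet.indicator (fun _ ↦ (1 : ℝ)) (x, T (sleDriving κ ω')) ∂P :=
      hG.stronglyMeasurable.integral_prod_right'
    simp_rw [hinnerT]
    exact h2.measurable
  have hinner_le1 : ∀ x, |∫ ω', F x (sleTrace κ ω') ∂P| ≤ 1 := fun x ↦ by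
    have h := norm_integral_le_of_norm_le_const (μ := P) (f := fun ω' ↦ F x (sleTrace κ ω')) (C := 1)
      (ae_of_all _ fun ω' ↦ by rw [Real.norm_eq_abs]; exact hFb _ _)
    rw [Real.norm_eq_abs, probReal_univ, mul_one] at h
    exact h
  -- the bound function
  set g : (ℝ≥0 → ℝ) → ℝ := fun ω ↦ (4 * ε * slePsiAt κ y n τ ω / y.im) ^ a *
    rsGhatSlope (1 - (κ : ℝ) / 8) κ (sleReAt κ y n τ ω / sleImAt κ y n τ ω) with hg
  have hGhat : ∀ v : ℝ, 0 < rsGhatSlope (1 - (κ : ℝ) / 8) κ v ∧ rsGhatSlope (1 - (κ : ℝ) / 8) κ v ≤ 1 := fun v ↦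
    rsGhatSlope_critical_mem_Ioc (by exact_mod_cast hκ) (by exact_mod_cast hκ8.le) v
  -- pointwise bound on `A' ∩ {τ < ∞}`
  have hpt : ∀ ω ∈ A' ∩ {ω | τ ω ≠ ⊤}, ∫ ω', F (X ω) (sleTrace κ ω') ∂P ≤ C * g ω := by
    rintro ω ⟨hωA', hωne⟩
    obtain ⟨r, hr⟩ := WithTop.ne_top_iff_exists.1 hωne
    have hrρ : ((r : ℝ≥0) : WithTop ℝ≥0) ≤ ρy ω := by rw [hr]; exact hωA'.2.1
    have hrT := coe_lt_swallowingTime_of_le_locTime hy hrρ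
    obtain ⟨hre, him, hpsi⟩ := sleAt_eq_of_eq_coe (κ := κ) (n := n) hy hr.symm hrρ
    have hW := continuous_sleDriving κ ω
    have hImpos : 0 < sleImAt κ y n τ ω := by rw [him]; exact im_centredMap_pos hW hy hrT
    have hψ1 : 1 ≤ slePsiAt κ y n τ ω := by rw [hpsi]; exact one_le_derivRatio hW hy hrT
    have hψ0 : 0 < slePsiAt κ y n τ ω := by linarith
    have hx1 : 0 < (X ω).1.im := by rw [hX1im]; exact hImpos
    have hx2 : 0 < (X ω).2 := by rw [hX2]; positivity
    have hεK : ε ≤ y.im / (128 * π * slePsiAt κ y n τ ω) := hωA'.2.2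
    have hx3 : (X ω).2 ≤ (X ω).1.im / 2 := by
      rw [hX2, hX1im]
      have h1 : ε * (128 * π * slePsiAt κ y n τ ω) ≤ y.im := (le_div_iff₀ (by positivity)).1 hεK
      have h8 : 4 * ε * slePsiAt κ y n τ ω ≤ y.im / 2 := by
        have hεψ : 0 ≤ ε * slePsiAt κ y n τ ω := by positivity
        nlinarith [Real.two_le_pi, hεψ]
      rw [div_le_iff₀ hy]
      calc 4 * ε * slePsiAt κ y n τ ω * sleImAt κ y n τ ω
          = sleImAt κ y n τ ω * (4 * ε * slePsiAt κ y n τ ω) := by ring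
        _ ≤ sleImAt κ y n τ ω * (y.im / 2) := mul_le_mul_of_nonneg_left h8 hImpos.le
        _ = sleImAt κ y n τ ω / 2 * y.im := by ring
    have h := hC (X ω) hx1 hx2 hx3
    have hratio : (X ω).2 / (X ω).1.im = 4 * ε * slePsiAt κ y n τ ω / y.im := by
      rw [hX2, hX1im]; field_simp
    rw [hratio, hX1re, hX1im] at h
    have : C * g ω = C * (4 * ε * slePsiAt κ y n τ ω / y.im) ^ (1 - (κ : ℝ) / 8) *
        rsGhatSlope (1 - (κ : ℝ) / 8) κ (sleReAt κ y n τ ω / sleImAt κ y n τ ω) := by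
      simp only [hg, ha]; ring
    rw [this]
    exact h
  -- integrability on `A' ∩ {τ < ∞}`
  set M : ℝ := Real.exp (4 / (y.im / (n + 2)) ^ 2 * ((n : ℝ) + 1)) with hM
  have hψle : ∀ ω, slePsiAt κ y n τ ω ≤ M := fun ω ↦
    stoppedProcess_slePointPsi_le hy (σ := ρy) (fun _ ↦ le_rfl) _ ω
  have hψge : ∀ ω, 1 ≤ slePsiAt κ y n τ ω := fun ω ↦
    one_le_stoppedProcess_slePointPsi hy (σ := ρy) (fun _ ↦ le_rfl) _ ω
  have hRem : Measurable (sleReAt κ y n τ) := hRe.mono hτ.measurableSpace_le le_rfl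
  have hImm : Measurable (sleImAt κ y n τ) := hIm.mono hτ.measurableSpace_le le_rfl
  have hPsim : Measurable (slePsiAt κ y n τ) := hPsi.mono hτ.measurableSpace_le le_rfl
  have hgm : Measurable g := by
    refine Measurable.mul ((((hPsim.const_mul _).div_const _).pow_const _)) ?_
    exact (contDiff_rsGhatSlope (n := 2) _ _).continuous.measurable.comp (hRem.div hImm)
  have hgbd : ∀ ω, ‖g ω‖ ≤ (4 * ε * M / y.im) ^ a := by
    intro ω
    have hb0 : 0 ≤ 4 * ε * slePsiAt κ y n τ ω / y.im := by
      have := hψge ω; positivity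
    have h1 : (4 * ε * slePsiAt κ y n τ ω / y.im) ^ a ≤ (4 * ε * M / y.im) ^ a := by
      have ha0 : 0 ≤ a := by
        have : (κ : ℝ) < 8 := by exact_mod_cast hκ8
        rw [ha]; linarith
      refine Real.rpow_le_rpow hb0 ?_ ha0
      exact div_le_div_of_nonneg_right (mul_le_mul_of_nonneg_left (hψle ω) (by positivity)) hy.le
    rw [hg, Real.norm_eq_abs, abs_of_nonneg (mul_nonneg (Real.rpow_nonneg hb0 _) (hGhat _).1.le)]
    calc (4 * ε * slePsiAt κ y n τ ω / y.im) ^ a * rsGhatSlope (1 - (κ : ℝ) / 8) κ (sleReAt κ y n τ ω / sleImAt κ y n τ ω)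
        ≤ (4 * ε * M / y.im) ^ a * 1 := mul_le_mul h1 (hGhat _).2 (hGhat _).1.le (Real.rpow_nonneg (by positivity) _)
      _ = (4 * ε * M / y.im) ^ a := mul_one _
  have hgint : Integrable (fun ω ↦ C * g ω) P :=
    (Integrable.of_bound hgm.aestronglyMeasurable _ (ae_of_all _ hgbd)).const_mul C
  have hinnint : Integrable (fun ω ↦ ∫ ω', F (X ω) (sleTrace κ ω') ∂P) P :=
    Integrable.of_bound (hinnerm.comp hXm).aestronglyMeasurable 1 (ae_of_all _ fun ω ↦ by
      rw [Real.norm_eq_abs]; exact hinner_le1 _)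
  have hmono : ∫ ω in A' ∩ {ω | τ ω ≠ ⊤}, (∫ ω', F (X ω) (sleTrace κ ω') ∂P) ∂P ≤
      ∫ ω in A' ∩ {ω | τ ω ≠ ⊤}, C * g ω ∂P :=
    setIntegral_mono_on hinnint.integrableOn hgint.integrableOn hA'm hpt
  -- assemble
  calc P.real (A ∩ {ω | τ ω ≠ ⊤} ∩ sleKoebeAt κ y n τ ε ∩ sleHitAfter κ y τ ε)
      ≤ ∫ ω in A' ∩ {ω | τ ω ≠ ⊤}, F (X ω) (sleTraceAfter κ τ ω) ∂P := hstep1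
    _ = ∫ ω in A' ∩ {ω | τ ω ≠ ⊤}, (∫ ω', F (X ω) (sleTrace κ ω') ∂P) ∂P := hfreeze
    _ ≤ ∫ ω in A' ∩ {ω | τ ω ≠ ⊤}, C * g ω ∂P := hmono
    _ = C * ∫ ω in A ∩ sleKoebeAt κ y n τ ε ∩ {ω | τ ω ≠ ⊤}, g ω ∂P := by
        rw [MeasureTheory.integral_const_mul]

end Main

end Literature.Probability.RandomPlanarGeometry
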